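/-
Copyright (c) 2026. All rights reserved.
Released under Apache 2.0 license as described in the file LICENSE.
-/
import Literature.AlgebraicGeometry.Pohlmann1968.DegenerateCMTypesMultiquadraticCMField
import Literature.NumberTheory.ComplexMultiplication.DegenerateCMTypesElementaryAbelianTwoGroup
import HarnessLib

/-!
# CM types of a MULTIQUADRATIC CM field of degree `≥ 8`: the PARITY of the multiplicities over the imaginary
# quadratic subfields; odd types are nondegenerate; degree `8`: rank `5` or `2`; degree `16`: rank `9`, `5` or `2`;
# rank `2` iff induced from an imaginary quadratic subfield

SETTING.  `K` a CM field, Galois over `ℚ` with `Gal(K/ℚ)` of exponent `2` (`g² = 1`; `K = ℚ(√−d, √a₁, …, √a_r)`,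
`[K:ℚ] = 2^{r+1}`), `Φ` a CM type of `K`.  For an imaginary quadratic subfield `F ⊆ K` and an embedding
`τ : F → ℂ`, the MULTIPLICITY of `Φ` at `τ` is `m_Φ(F, τ) = #{φ ∈ Φ : φ|_F = τ}` (so `m_Φ(F, τ) + m_Φ(F, τ̄) =
[K:ℚ]/2`, and `Φ` is of Weil type — balanced — over `F` iff `m_Φ(F, τ) = m_Φ(F, τ̄)`; B. Dodson [Dodson1984] §3.1.1:
the weight of the type over the imaginary quadratic subfield; B. B. Gordon [Gordon1999HodgeAVSurvey] 5.13: "an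
imaginary quadratic field acting with multiplicities `(p, q)`").  On `Gal(K/ℚ)` (`S = {g : σ_g ∈ Φ}`, `σ_g = φ₀ ∘
g⁻¹`), `m_Φ(F, φ₀|_F) = #(S ∩ Gal(K/F))` and `m_Φ(F, conj ∘ φ₀|_F) = #(S ∖ Gal(K/F)) = a_χ(S)` for the sign
character `χ` of `Gal(K/F)` (§1) — so the group-level theory of CM types on elementary abelian `2`-groups
(`NumberTheory/ComplexMultiplication/DegenerateCMTypesElementaryAbelianTwoGroup`, seat p10 g37-#3: common parity of
the sign counts, Parseval over the odd characters, rank spectra) reads on `K` as follows (T. Kubota [Kubota1965] §4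
Lemma 2 throughout):

* §1 `ncard_fibre_add_ncard_fibre_conjugate` (`m_Φ(F, τ) + m_Φ(F, τ̄) = [K:ℚ]/2`), and the dictionary
  (`card_filter_mem_fixingSubgroup_eq_ncard`, `card_filter_not_mem_fixingSubgroup_eq_ncard`).
* §2 **`ncard_fibre_mod_two_eq`** — THE PARITY OF A CM TYPE: if `8 ∣ [K:ℚ]`, the multiplicities `m_Φ(F, τ)` over
  ALL imaginary quadratic subfields `F ⊆ K` and all `τ : F → ℂ` have the same parity.
* §3 **`isNondegenerate_of_odd_ncard_fibre`** — ODD TYPES ARE NONDEGENERATE (`8 ∣ [K:ℚ]`): if some (equivalently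
  every) multiplicity `m_Φ(F, τ)` is odd, then `Φ` is of Weil type over no imaginary quadratic subfield and
  `Rank(Φ) = [K:ℚ]/2 + 1`; `even_ncard_fibre_of_not_isNondegenerate`; **`sixteen_mul_cmTypeRank_sub_one_le`** (even
  multiplicity ⟹ `16(Rank(Φ) − 1) ≤ ([K:ℚ]/2)²`).
* §4 DEGREE `8` (triquadratic CM fields `ℚ(√−d, √a, √b)`, e.g. `ℚ(ζ₂₄)`): **`cmTypeRank_eq_five_or_two_of_finrank_eq_eight`**
  (EVERY CM type has rank `5` or `2`), **`isNondegenerate_iff_odd_of_finrank_eq_eight`** (nondegenerate ⟺ odd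
  multiplicities), `cmTypeRank_eq_two_iff_even_of_finrank_eq_eight`; Dodson's §3.3.2 Theorem read for abelian octic
  CM fields: a SIMPLE CM abelian fourfold with Galois group `(ℤ/2)³` is nondegenerate (rank `2` means induced, hence a
  non-trivial stabiliser, §6 `exists_ne_one_stabilizer_of_cmTypeRank_eq_two`).  DEGREE `16`:
  **`cmTypeRank_mem_of_finrank_eq_sixteen`** (rank `9`, `5` or `2`), `cmTypeRank_eq_five_or_two_of_even_of_finrank_eq_sixteen`.
* §5 `cyclotomic_twentyFour_rank` (`ℚ(ζ₂₄)`: every CM type has rank `5` or `2`; nondegenerate iff its multiplicities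
  over `ℚ(i)`, `ℚ(√−2)`, `ℚ(√−3)`, `ℚ(√−6)` are odd).
* §6 **`cmTypeRank_eq_two_iff_exists_eq_fibre`** — for EVERY multiquadratic CM field: `Rank(Φ) = 2` iff `Φ` is the
  set of ALL extensions to `K` of one embedding `τ` of an imaginary quadratic subfield `F` (`Φ = {φ : φ|_F = τ}`: the
  type induced from `(F, {τ})`, the abelian varieties of type `Φ` are isogenous to powers of a CM elliptic curve);
  `exists_ne_one_stabilizer_of_cmTypeRank_eq_two` (`[K:ℚ] ≥ 8`: such a `Φ` is stable under `Gal(K/F) ≠ 1`).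

HONEST SCOPE.  As for the group-level file: consequences of Kubota's Lemma 2 and character orthogonality in
exponent `2`, read through the Galois correspondence; the parity invariant and the rank spectra are this
regrouping, not printed formulas (Dodson §3.3.2 and Moonen–Zarhin classify degenerate simple CM fourfolds in
general; here only the abelian-octic case is touched, as "rank `2` ⟹ induced").  Algebraicity of Hodge classes is
not discussed.  THEOREMS ONLY: no definition, no named fact, no instance, no `sorry`.

## References

* [Kubota1965] T. Kubota, Trans. AMS 118 (1965), §4 Lemma 2 (held text, p. 119).
* [Dodson1984] B. Dodson, *The structure of Galois groups of CM-fields*, Trans. AMS 283 (1984), §3.1.1 Theorem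
  (constant weight criterion), §3.3.2 Theorem (held text, pp. 11–12, 16).
* [Gordon1999HodgeAVSurvey] B. B. Gordon, *A survey of the Hodge conjecture for abelian varieties*, 5.13, 9.4.1.
* [MoonenZarhin1999LowDim] B. Moonen, Yu. Zarhin, Math. Ann. 315 (1999), Thm. (0.2).
* [Shimura1998] G. Shimura, *Abelian Varieties with Complex Multiplication and Modular Functions*, §8.2 Prop. 26,
  §8.4 Example (2)(A), §18.2.

## Provenance

Lane `lit-hodgefound` (Track 2, Layer A4), seat `lit-hodgefound-p10` generation 37, row g37-#4 (field dress of
g37-#3); neighbours cited by name, nothing restated: `DegenerateCMTypesElementaryAbelianTwoGroup` (group level),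
`DegenerateCMTypesMultiquadraticCMField` (g37-#2: the exact rank formula, `isCyclic_quotient_iff_index_eq_two`,
`cyclotomic_twentyFour`), `DegenerateCMTypesAbelianCMFieldCyclicSubfields` (g37-#1: `mem_fixingSubgroup_iff_embOf_comp_eq`,
`not_mem_fixingSubgroup_iff_embOf_comp_eq_conjugate`, `conjGal_not_mem_iff_not_isTotallyReal_fixedField`,
`index_eq_finrank_fixedField`), `CosetGermGaloisSetting` (`conjGal_not_mem_fixingSubgroup_iff`,
`index_fixingSubgroup_eq_two`), `CMSubfieldPairGaloisCriterion` (`exists_comp_eq`), `DegenerateCMTypesAbelianKernels`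
(`exists_oddChar_ker`), `NondegenerateCMTypeDivisorClasses` (`isNondegenerate_iff`).
-/

open scoped BigOperators NumberField IsMulCommutative Classical
open NumberField IntermediateField

namespace Literature.AlgebraicGeometry.Pohlmann1968

namespace Multiquadratic

open Literature.NumberTheory.ComplexMultiplication
open Literature.NumberTheory.ComplexMultiplication.CMNumbers
open Literature.AlgebraicGeometry.Motives (CMType)
open Literature.AlgebraicGeometry.Pohlmann1968.CyclicTwoOddPrimes (isCMTypeWith_galType cmTypeRank_eq_typeRank_galType)
open Literature.AlgebraicGeometry.Pohlmann1968.AbelianKernels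

variable {K : Type} [Field K] [NumberField K] [IsCMField K]

/-! ## §0 Helpers -/

section Helpers

/-- A group of exponent `2` is commutative. [folklore] -/
private theorem mul_comm_of_sq_eq_one' {G : Type*} [Group G] (hexp : ∀ g : G, g ^ 2 = 1) (a b : G) :
    a * b = b * a := by
  have hinv : ∀ x : G, x⁻¹ = x := fun x => inv_eq_of_mul_eq_one_right (by rw [← pow_two]; exact hexp x)
  calc a * b = (a * b)⁻¹ := (hinv _).symm
    _ = b⁻¹ * a⁻¹ := mul_inv_rev a b
    _ = b * a := by rw [hinv, hinv]

omit [IsCMField K] in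
/-- A Galois extension whose Galois group has exponent `2` is abelian. [folklore] -/
private theorem isAbelianGalois_of_sq_eq_one' [IsGalois ℚ K] (hexp : ∀ g : K ≃ₐ[ℚ] K, g ^ 2 = 1) :
    IsAbelianGalois ℚ K :=
  { is_comm.comm := mul_comm_of_sq_eq_one' hexp }

omit [IsCMField K] in
/-- The multiplicity of `Φ` over an embedding `τ` of `F`, counted on `Gal(K/ℚ)`:
`#{s ∈ S : σ_s|_F = τ} = #{φ ∈ Φ : φ|_F = τ}`. [folklore] -/
private theorem card_filter_embOf_comp_eq' [Normal ℚ K] (φ₀ : K →+* ℂ) (Φ : CMType K)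
    (F : IntermediateField ℚ K) (τ : F →+* ℂ) :
    ((Finset.univ.filter fun g : K ≃ₐ[ℚ] K => embOf φ₀ g ∈ Φ.1).filter
        fun s => (embOf φ₀ s).comp (algebraMap F K) = τ).card =
      {φ : K →+* ℂ | φ.comp (algebraMap F K) = τ ∧ φ ∈ Φ.1}.ncard := by
  have h1 : {φ : K →+* ℂ | φ.comp (algebraMap F K) = τ ∧ φ ∈ Φ.1} =
      ↑(Finset.univ.filter fun φ : K →+* ℂ => φ.comp (algebraMap F K) = τ ∧ φ ∈ Φ.1) := by
    ext φ; simp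
  rw [h1, Set.ncard_coe_finset]
  have h2 : (Finset.univ.filter fun φ : K →+* ℂ => φ.comp (algebraMap F K) = τ ∧ φ ∈ Φ.1) =
      (((Finset.univ.filter fun g : K ≃ₐ[ℚ] K => embOf φ₀ g ∈ Φ.1).filter
        fun s => (embOf φ₀ s).comp (algebraMap F K) = τ)).image (embOf φ₀) := by
    ext φ
    simp only [Finset.mem_filter, Finset.mem_univ, true_and, Finset.mem_image]
    constructor
    · rintro ⟨hφ, hφΦ⟩
      obtain ⟨g, rfl⟩ := (embOf_bijective φ₀).2 φ
      exact ⟨g, ⟨hφΦ, hφ⟩, rfl⟩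
    · rintro ⟨g, ⟨hg, hres⟩, rfl⟩
      exact ⟨hres, hg⟩
  rw [h2, Finset.card_image_of_injective _ (embOf_bijective φ₀).1]

omit [IsCMField K] in
/-- Every complex embedding of a subfield `F ⊆ K` is a restriction `σ_g|_F` (`K/ℚ` normal). [folklore] -/
private theorem exists_embOf_comp_eq [Normal ℚ K] (φ₀ : K →+* ℂ) (F : IntermediateField ℚ K) (τ : F →+* ℂ) :
    ∃ g : K ≃ₐ[ℚ] K, (embOf φ₀ g).comp (algebraMap F K) = τ := by
  obtain ⟨g, hg⟩ := exists_comp_eq F φ₀ τ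
  refine ⟨g⁻¹, ?_⟩
  rw [← hg]
  exact RingHom.ext fun x => rfl

end Helpers

/-! ## §1 The multiplicities of `Φ` over an imaginary quadratic subfield, on `Gal(K/ℚ)` -/

section Dictionary

variable [IsAbelianGalois ℚ K]

/-- `2·#S = [K:ℚ]` for `S = {g : σ_g ∈ Φ}` (a CM type on `Gal(K/ℚ)`). [folklore] -/
private theorem two_mul_card_galType (φ₀ : K →+* ℂ) (Φ : CMType K) :
    2 * (Finset.univ.filter fun g : K ≃ₐ[ℚ] K => embOf φ₀ g ∈ Φ.1).card = Module.finrank ℚ K := by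
  have h := isCMTypeWith_galType (AbelianCMFieldExistence.apply_conjGal_eq φ₀) Φ
  have hρT : ∀ x : K ≃ₐ[ℚ] K, conjGal * x ∈ (Finset.univ.filter fun g : K ≃ₐ[ℚ] K => embOf φ₀ g ∈ Φ.1) ↔
      x ∉ (Finset.univ.filter fun g : K ≃ₐ[ℚ] K => embOf φ₀ g ∈ Φ.1) := fun x => by
    have := h.rho_smul_mem_iff x
    simpa only [smul_eq_mul, Finset.mem_coe] using this
  have hρ2 : (conjGal : K ≃ₐ[ℚ] K) * conjGal = 1 := conjGal_mul_conjGal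
  have hinj : Function.Injective fun s : K ≃ₐ[ℚ] K => conjGal * s := fun a b hab => mul_left_cancel hab
  have hc : (Finset.univ.filter fun g : K ≃ₐ[ℚ] K => embOf φ₀ g ∈ Φ.1)ᶜ =
      (Finset.univ.filter fun g : K ≃ₐ[ℚ] K => embOf φ₀ g ∈ Φ.1).image fun s => conjGal * s := by
    ext x
    rw [Finset.mem_compl, Finset.mem_image]
    constructor
    · intro hx
      exact ⟨conjGal * x, (hρT x).2 hx, by rw [← mul_assoc, hρ2, one_mul]⟩
    · rintro ⟨s, hs, rfl⟩
      exact fun hx => ((hρT s).1 hx) hs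
  have h1 : (Finset.univ.filter fun g : K ≃ₐ[ℚ] K => embOf φ₀ g ∈ Φ.1)ᶜ.card =
      (Finset.univ.filter fun g : K ≃ₐ[ℚ] K => embOf φ₀ g ∈ Φ.1).card := by
    rw [hc, Finset.card_image_of_injective _ hinj]
  have h2 := Finset.card_add_card_compl (Finset.univ.filter fun g : K ≃ₐ[ℚ] K => embOf φ₀ g ∈ Φ.1)
  rw [card_gal_eq_finrank φ₀] at h2
  omega

omit [IsCMField K] in
/-- **`m_Φ(F, φ₀|_F) = #(S ∩ Gal(K/F))`**: the elements of `S = {g : σ_g ∈ Φ}` fixing `F` are the `φ ∈ Φ`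
extending the base embedding of `F`. [cite: Dodson1984, §3.1.1 Theorem (proof)] [cite: Shimura1998, §18.2 Lemma (i)] -/
theorem card_filter_mem_fixingSubgroup_eq_ncard (φ₀ : K →+* ℂ) (Φ : CMType K) (F : IntermediateField ℚ K) :
    ((Finset.univ.filter fun g : K ≃ₐ[ℚ] K => embOf φ₀ g ∈ Φ.1).filter fun s => s ∈ F.fixingSubgroup).card =
      {φ : K →+* ℂ | φ.comp (algebraMap F K) = φ₀.comp (algebraMap F K) ∧ φ ∈ Φ.1}.ncard := by
  rw [← card_filter_embOf_comp_eq' φ₀ Φ F]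
  congr 1
  exact Finset.filter_congr fun s _ => mem_fixingSubgroup_iff_embOf_comp_eq φ₀ F s

/-- **`m_Φ(F, conj ∘ φ₀|_F) = #(S ∖ Gal(K/F))`** for an imaginary quadratic subfield `F`: the elements of `S`
moving `F` are the `φ ∈ Φ` extending the conjugate embedding of `F`.
[cite: Dodson1984, §3.1.1 Theorem (proof)] [cite: Shimura1998, §18.2 Lemma (i)] -/
theorem card_filter_not_mem_fixingSubgroup_eq_ncard (φ₀ : K →+* ℂ) (Φ : CMType K) (F : IntermediateField ℚ K)
    (h2 : Module.finrank ℚ F = 2) (hF : ¬ IsTotallyReal F) :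
    ((Finset.univ.filter fun g : K ≃ₐ[ℚ] K => embOf φ₀ g ∈ Φ.1).filter fun s => s ∉ F.fixingSubgroup).card =
      {φ : K →+* ℂ | φ.comp (algebraMap F K) = ComplexEmbedding.conjugate (φ₀.comp (algebraMap F K)) ∧
        φ ∈ Φ.1}.ncard := by
  rw [← card_filter_embOf_comp_eq' φ₀ Φ F]
  congr 1
  exact Finset.filter_congr fun s _ => not_mem_fixingSubgroup_iff_embOf_comp_eq_conjugate φ₀ F h2 hF s

/-- **`m_Φ(F, τ) + m_Φ(F, τ̄) = [K:ℚ]/2`**: the two multiplicities of a CM type over an imaginary quadratic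
subfield add up to `|Φ|`. [cite: Dodson1984, §3.1.1 Theorem] [cite: Gordon1999HodgeAVSurvey, 5.13] -/
theorem ncard_fibre_add_ncard_fibre_conjugate (Φ : CMType K) (F : IntermediateField ℚ K)
    (h2 : Module.finrank ℚ F = 2) (hF : ¬ IsTotallyReal F) (τ : F →+* ℂ) :
    {φ : K →+* ℂ | φ.comp (algebraMap F K) = τ ∧ φ ∈ Φ.1}.ncard +
      {φ : K →+* ℂ | φ.comp (algebraMap F K) = ComplexEmbedding.conjugate τ ∧ φ ∈ Φ.1}.ncard =
        Module.finrank ℚ K / 2 := by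
  -- choose the base embedding `φ₀` extending `τ`
  obtain ⟨φ₁⟩ := (inferInstance : Nonempty (K →+* ℂ))
  obtain ⟨g, hg⟩ := exists_embOf_comp_eq φ₁ F τ
  set φ₀ : K →+* ℂ := embOf φ₁ g with hφ₀
  rw [← hg, ← card_filter_mem_fixingSubgroup_eq_ncard φ₀ Φ F,
    ← card_filter_not_mem_fixingSubgroup_eq_ncard φ₀ Φ F h2 hF, Finset.card_filter_add_card_filter_not]
  have hS := two_mul_card_galType φ₀ Φ
  omega

omit [IsCMField K] in
/-- For the sign character `χ` of `Gal(K/F)` (`ker χ = Gal(K/F)`): `{s ∈ S : χ(s) = −1} = S ∖ Gal(K/F)`.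
[cite: Kubota1965, §4 Lemma 2] -/
theorem filter_char_eq_neg_one_eq (hexp : ∀ g : K ≃ₐ[ℚ] K, g ^ 2 = 1) (S : Finset (K ≃ₐ[ℚ] K))
    (F : IntermediateField ℚ K) {χ : AddChar (Additive (K ≃ₐ[ℚ] K)) ℂ}
    (hker : ∀ g : K ≃ₐ[ℚ] K, χ (Additive.ofMul g) = 1 ↔ g ∈ F.fixingSubgroup) :
    (S.filter fun s => χ (Additive.ofMul s) = -1) = S.filter fun s => s ∉ F.fixingSubgroup := by
  refine Finset.filter_congr fun s _ => ?_
  rw [← hker s]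
  constructor
  · intro h1 h2; rw [h2] at h1; norm_num at h1
  · intro h1
    exact (character_apply_eq_one_or_of_mul_self χ (by rw [← pow_two]; exact hexp s)).resolve_left h1

/-- **The sign character of an imaginary quadratic subfield exists**: a character `χ` of `Gal(K/ℚ)` with
`χ(ρ) = −1` and kernel exactly `Gal(K/F)`. [cite: Kubota1965, §4 Lemma 2] [cite: Dodson1984, §3.1.1 Theorem] -/
theorem exists_signChar (hexp : ∀ g : K ≃ₐ[ℚ] K, g ^ 2 = 1) (F : IntermediateField ℚ K)
    (h2 : Module.finrank ℚ F = 2) (hF : ¬ IsTotallyReal F) :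
    ∃ χ : AddChar (Additive (K ≃ₐ[ℚ] K)) ℂ, χ (Additive.ofMul (conjGal : K ≃ₐ[ℚ] K)) = -1 ∧
      ∀ g : K ≃ₐ[ℚ] K, χ (Additive.ofMul g) = 1 ↔ g ∈ F.fixingSubgroup := by
  have hρH : (conjGal : K ≃ₐ[ℚ] K) ∉ F.fixingSubgroup := (conjGal_not_mem_fixingSubgroup_iff F).2 hF
  exact CyclicCMType.AbelianKernels.exists_oddChar_ker hρH conjGal_mul_conjGal
    ((isCyclic_quotient_iff_index_eq_two hexp hρH).2 (index_fixingSubgroup_eq_two F h2))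

/-- **The multiplicity has the parity of the sign count**: for `4 ∣ [K:ℚ]`, an imaginary quadratic subfield `F`,
its sign character `χ` and ANY `τ : F → ℂ`: `m_Φ(F, τ) ≡ a_χ(S) (mod 2)` (`m_Φ(F, τ̄₀) = a_χ(S)` and
`m_Φ(F, τ₀) = [K:ℚ]/2 − a_χ(S)`). [cite: Kubota1965, §4 Lemma 2] [cite: Dodson1984, §3.1.1 Theorem] -/
theorem ncard_fibre_mod_two_eq_card_filter_mod_two (hexp : ∀ g : K ≃ₐ[ℚ] K, g ^ 2 = 1)
    (h4 : 4 ∣ Module.finrank ℚ K) (φ₀ : K →+* ℂ) (Φ : CMType K) (F : IntermediateField ℚ K)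
    (h2 : Module.finrank ℚ F = 2) (hF : ¬ IsTotallyReal F) {χ : AddChar (Additive (K ≃ₐ[ℚ] K)) ℂ}
    (hker : ∀ g : K ≃ₐ[ℚ] K, χ (Additive.ofMul g) = 1 ↔ g ∈ F.fixingSubgroup) (τ : F →+* ℂ) :
    {φ : K →+* ℂ | φ.comp (algebraMap F K) = τ ∧ φ ∈ Φ.1}.ncard % 2 =
      ((Finset.univ.filter fun g : K ≃ₐ[ℚ] K => embOf φ₀ g ∈ Φ.1).filter
        fun s => χ (Additive.ofMul s) = -1).card % 2 := by
  rw [filter_char_eq_neg_one_eq hexp _ F hker, card_filter_not_mem_fixingSubgroup_eq_ncard φ₀ Φ F h2 hF]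
  have hsum := ncard_fibre_add_ncard_fibre_conjugate Φ F h2 hF (φ₀.comp (algebraMap F K))
  -- `τ` is `φ₀|_F` or its conjugate
  obtain ⟨g, hg⟩ := exists_embOf_comp_eq φ₀ F τ
  by_cases hmem : g ∈ F.fixingSubgroup
  · have hτ : τ = φ₀.comp (algebraMap F K) := hg.symm.trans ((mem_fixingSubgroup_iff_embOf_comp_eq φ₀ F g).1 hmem)
    rw [hτ]
    obtain ⟨c, hc⟩ := h4
    omega
  · have hτ : τ = ComplexEmbedding.conjugate (φ₀.comp (algebraMap F K)) :=
      hg.symm.trans ((not_mem_fixingSubgroup_iff_embOf_comp_eq_conjugate φ₀ F h2 hF g).1 hmem)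
    rw [hτ]

end Dictionary

/-! ## §2 The parity of a CM type of a multiquadratic CM field of degree `≥ 8` -/

section Parity

variable [IsGalois ℚ K]

/-- **THE PARITY OF A CM TYPE.**  Let `K` be a multiquadratic CM field with `8 ∣ [K:ℚ]` and `Φ` a CM type.  Then
the multiplicities `m_Φ(F, τ) = #{φ ∈ Φ : φ|_F = τ}` over ALL imaginary quadratic subfields `F ⊆ K` and all
embeddings `τ : F → ℂ` have the same parity (on `Gal(K/ℚ)`: the sign counts of a CM type on an elementary abelian
`2`-group of order divisible by `8` have a common parity, `CyclicCMType.ExponentTwo.card_filter_mod_two_eq`).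
[cite: Kubota1965, §4 Lemma 2] [cite: Dodson1984, §3.1.1 Theorem] -/
theorem ncard_fibre_mod_two_eq (hexp : ∀ g : K ≃ₐ[ℚ] K, g ^ 2 = 1) (h8 : 8 ∣ Module.finrank ℚ K) (Φ : CMType K)
    (F : IntermediateField ℚ K) (h2 : Module.finrank ℚ F = 2) (hF : ¬ IsTotallyReal F) (τ : F →+* ℂ)
    (F' : IntermediateField ℚ K) (h2' : Module.finrank ℚ F' = 2) (hF' : ¬ IsTotallyReal F') (τ' : F' →+* ℂ) :
    {φ : K →+* ℂ | φ.comp (algebraMap F K) = τ ∧ φ ∈ Φ.1}.ncard % 2 =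
      {φ : K →+* ℂ | φ.comp (algebraMap F' K) = τ' ∧ φ ∈ Φ.1}.ncard % 2 := by
  haveI := isAbelianGalois_of_sq_eq_one' hexp
  obtain ⟨φ₀⟩ := (inferInstance : Nonempty (K →+* ℂ))
  have h4 : 4 ∣ Module.finrank ℚ K := dvd_trans (by norm_num) h8
  obtain ⟨χ, hχρ, hker⟩ := exists_signChar hexp F h2 hF
  obtain ⟨χ', hχ'ρ, hker'⟩ := exists_signChar hexp F' h2' hF'
  rw [ncard_fibre_mod_two_eq_card_filter_mod_two hexp h4 φ₀ Φ F h2 hF hker τ,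
    ncard_fibre_mod_two_eq_card_filter_mod_two hexp h4 φ₀ Φ F' h2' hF' hker' τ']
  have h8' : 8 ∣ Fintype.card (K ≃ₐ[ℚ] K) := by rwa [card_gal_eq_finrank φ₀]
  exact CyclicCMType.ExponentTwo.card_filter_mod_two_eq hexp
    (isCMTypeWith_galType (AbelianCMFieldExistence.apply_conjGal_eq φ₀) Φ) h8' hχρ hχ'ρ

end Parity

/-! ## §3 Odd types are nondegenerate; even types -/

section OddEven

variable [IsGalois ℚ K]

/-- **ODD TYPES ARE NONDEGENERATE.**  Let `K` be a multiquadratic CM field with `8 ∣ [K:ℚ]`, `Φ` a CM type, and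
suppose that over some imaginary quadratic subfield `F` some multiplicity `m_Φ(F, τ)` is ODD.  Then `Φ` is
nondegenerate: `Rank(Φ) = [K:ℚ]/2 + 1` (no sign character vanishes: `Σ_S χ = [K:ℚ]/2 − 2a_χ(S) ≡ 2 (mod 4)`).
[cite: Kubota1965, §4 Lemma 2] [cite: Dodson1984, §3.1.1 Theorem] -/
theorem isNondegenerate_of_odd_ncard_fibre (hexp : ∀ g : K ≃ₐ[ℚ] K, g ^ 2 = 1) (h8 : 8 ∣ Module.finrank ℚ K)
    (Φ : CMType K) (F : IntermediateField ℚ K) (h2 : Module.finrank ℚ F = 2) (hF : ¬ IsTotallyReal F)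
    (τ : F →+* ℂ) (hodd : Odd {φ : K →+* ℂ | φ.comp (algebraMap F K) = τ ∧ φ ∈ Φ.1}.ncard) :
    IsNondegenerate Φ := by
  haveI := isAbelianGalois_of_sq_eq_one' hexp
  obtain ⟨φ₀⟩ := (inferInstance : Nonempty (K →+* ℂ))
  have h4 : 4 ∣ Module.finrank ℚ K := dvd_trans (by norm_num) h8
  obtain ⟨χ, hχρ, hker⟩ := exists_signChar hexp F h2 hF
  have hpar := ncard_fibre_mod_two_eq_card_filter_mod_two hexp h4 φ₀ Φ F h2 hF hker τ
  have hodd' : Odd (((Finset.univ.filter fun g : K ≃ₐ[ℚ] K => embOf φ₀ g ∈ Φ.1).filter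
      fun s => χ (Additive.ofMul s) = -1).card) := by
    rw [Nat.odd_iff] at hodd ⊢
    omega
  have h8' : 8 ∣ Fintype.card (K ≃ₐ[ℚ] K) := by rwa [card_gal_eq_finrank φ₀]
  rw [_root_.Literature.AlgebraicGeometry.Pohlmann1968.isNondegenerate_iff, cmTypeRank_eq_typeRank_galType Φ φ₀,
    ← card_gal_eq_finrank φ₀]
  exact CyclicCMType.ExponentTwo.typeRank_eq_of_odd hexp
    (isCMTypeWith_galType (AbelianCMFieldExistence.apply_conjGal_eq φ₀) Φ) h8' hχρ hodd'

/-- **A degenerate type has even multiplicities** over every imaginary quadratic subfield (`8 ∣ [K:ℚ]`).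
[cite: Kubota1965, §4 Lemma 2] [cite: Dodson1984, §3.1.1 Theorem] -/
theorem even_ncard_fibre_of_not_isNondegenerate (hexp : ∀ g : K ≃ₐ[ℚ] K, g ^ 2 = 1)
    (h8 : 8 ∣ Module.finrank ℚ K) (Φ : CMType K) (hnd : ¬ IsNondegenerate Φ) (F : IntermediateField ℚ K)
    (h2 : Module.finrank ℚ F = 2) (hF : ¬ IsTotallyReal F) (τ : F →+* ℂ) :
    Even {φ : K →+* ℂ | φ.comp (algebraMap F K) = τ ∧ φ ∈ Φ.1}.ncard := by
  by_contra hodd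
  rw [Nat.not_even_iff_odd] at hodd
  exact hnd (isNondegenerate_of_odd_ncard_fibre hexp h8 Φ F h2 hF τ hodd)

/-- **EVEN TYPES: `16·(Rank(Φ) − 1) ≤ ([K:ℚ]/2)²`** (`8 ∣ [K:ℚ]`, some multiplicity even): every sign-character
sum is `≡ 0 (mod 4)` and Parseval over the odd characters bounds the number of survivors.
[cite: Kubota1965, §4 Lemma 2] -/
theorem sixteen_mul_cmTypeRank_sub_one_le (hexp : ∀ g : K ≃ₐ[ℚ] K, g ^ 2 = 1) (h8 : 8 ∣ Module.finrank ℚ K)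
    (Φ : CMType K) (F : IntermediateField ℚ K) (h2 : Module.finrank ℚ F = 2) (hF : ¬ IsTotallyReal F)
    (τ : F →+* ℂ) (heven : Even {φ : K →+* ℂ | φ.comp (algebraMap F K) = τ ∧ φ ∈ Φ.1}.ncard) :
    16 * (cmTypeRank Φ - 1) ≤ (Module.finrank ℚ K / 2) ^ 2 := by
  haveI := isAbelianGalois_of_sq_eq_one' hexp
  obtain ⟨φ₀⟩ := (inferInstance : Nonempty (K →+* ℂ))
  have h4 : 4 ∣ Module.finrank ℚ K := dvd_trans (by norm_num) h8
  obtain ⟨χ, hχρ, hker⟩ := exists_signChar hexp F h2 hF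
  have hpar := ncard_fibre_mod_two_eq_card_filter_mod_two hexp h4 φ₀ Φ F h2 hF hker τ
  have heven' : Even (((Finset.univ.filter fun g : K ≃ₐ[ℚ] K => embOf φ₀ g ∈ Φ.1).filter
      fun s => χ (Additive.ofMul s) = -1).card) := by
    rw [Nat.even_iff] at heven ⊢
    omega
  have h8' : 8 ∣ Fintype.card (K ≃ₐ[ℚ] K) := by rwa [card_gal_eq_finrank φ₀]
  have hcm := isCMTypeWith_galType (AbelianCMFieldExistence.apply_conjGal_eq φ₀) Φ
  have hle := CyclicCMType.ExponentTwo.sixteen_mul_typeRank_sub_one_le hexp hcm h8' hχρ heven'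
  have hS := two_mul_card_galType φ₀ Φ
  rw [cmTypeRank_eq_typeRank_galType Φ φ₀]
  have : (Finset.univ.filter fun g : K ≃ₐ[ℚ] K => embOf φ₀ g ∈ Φ.1).card = Module.finrank ℚ K / 2 := by omega
  rw [← this]
  exact hle

end OddEven

/-! ## §4 Degree `8`: rank `5` or `2`; degree `16`: rank `9`, `5` or `2` -/

section Degrees

variable [IsGalois ℚ K]

/-- **EVERY CM TYPE OF A TRIQUADRATIC CM FIELD (`[K:ℚ] = 8`, `Gal ≅ (ℤ/2)³`) HAS RANK `5` OR `2`** — rank `5`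
(nondegenerate) for the odd types, rank `2` for the even ones; no type of rank `3` or `4`.  Dodson §3.3.2: a simple
CM abelian fourfold is degenerate only for the Galois groups `ℤ₂ × A₄`, `ℤ₂ × S₄` — never for `(ℤ/2)³`.
[cite: Kubota1965, §4 Lemma 2] [cite: Dodson1984, §3.3.2 Theorem] [cite: MoonenZarhin1999LowDim, Thm. (0.2)] -/
theorem cmTypeRank_eq_five_or_two_of_finrank_eq_eight (hexp : ∀ g : K ≃ₐ[ℚ] K, g ^ 2 = 1)
    (h8 : Module.finrank ℚ K = 8) (Φ : CMType K) : cmTypeRank Φ = 5 ∨ cmTypeRank Φ = 2 := by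
  haveI := isAbelianGalois_of_sq_eq_one' hexp
  obtain ⟨φ₀⟩ := (inferInstance : Nonempty (K →+* ℂ))
  rw [cmTypeRank_eq_typeRank_galType Φ φ₀]
  exact CyclicCMType.ExponentTwo.typeRank_eq_five_or_two_of_card_eight hexp
    (isCMTypeWith_galType (AbelianCMFieldExistence.apply_conjGal_eq φ₀) Φ) (by rw [card_gal_eq_finrank φ₀, h8])

/-- **Degree `8`: nondegenerate ⟺ odd multiplicities** over (some, equivalently every) imaginary quadratic
subfield. [cite: Kubota1965, §4 Lemma 2] [cite: Dodson1984, §3.1.1 Theorem] -/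
theorem isNondegenerate_iff_odd_of_finrank_eq_eight (hexp : ∀ g : K ≃ₐ[ℚ] K, g ^ 2 = 1)
    (h8 : Module.finrank ℚ K = 8) (Φ : CMType K) (F : IntermediateField ℚ K) (h2 : Module.finrank ℚ F = 2)
    (hF : ¬ IsTotallyReal F) (τ : F →+* ℂ) :
    IsNondegenerate Φ ↔ Odd {φ : K →+* ℂ | φ.comp (algebraMap F K) = τ ∧ φ ∈ Φ.1}.ncard := by
  constructor
  · intro hnd
    by_contra hev
    rw [Nat.not_odd_iff_even] at hev
    have hle := sixteen_mul_cmTypeRank_sub_one_le hexp (by rw [h8]) Φ F h2 hF τ hev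
    rw [_root_.Literature.AlgebraicGeometry.Pohlmann1968.isNondegenerate_iff, h8] at hnd
    rw [hnd, h8] at hle
    norm_num at hle
  · exact isNondegenerate_of_odd_ncard_fibre hexp (by rw [h8]) Φ F h2 hF τ

/-- **Degree `8`: rank `2` ⟺ even multiplicities.** [cite: Kubota1965, §4 Lemma 2] [cite: Dodson1984, §3.1.1 Theorem] -/
theorem cmTypeRank_eq_two_iff_even_of_finrank_eq_eight (hexp : ∀ g : K ≃ₐ[ℚ] K, g ^ 2 = 1)
    (h8 : Module.finrank ℚ K = 8) (Φ : CMType K) (F : IntermediateField ℚ K) (h2 : Module.finrank ℚ F = 2)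
    (hF : ¬ IsTotallyReal F) (τ : F →+* ℂ) :
    cmTypeRank Φ = 2 ↔ Even {φ : K →+* ℂ | φ.comp (algebraMap F K) = τ ∧ φ ∈ Φ.1}.ncard := by
  rw [← Nat.not_odd_iff_even, ← isNondegenerate_iff_odd_of_finrank_eq_eight hexp h8 Φ F h2 hF τ,
    _root_.Literature.AlgebraicGeometry.Pohlmann1968.isNondegenerate_iff, h8]
  have := cmTypeRank_eq_five_or_two_of_finrank_eq_eight hexp h8 Φ
  omega

/-- **EVERY CM TYPE OF A MULTIQUADRATIC CM FIELD OF DEGREE `16` HAS RANK `9`, `5` OR `2`** (`9` for the odd types;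
`5` or `2` for the even ones). [cite: Kubota1965, §4 Lemma 2] -/
theorem cmTypeRank_mem_of_finrank_eq_sixteen (hexp : ∀ g : K ≃ₐ[ℚ] K, g ^ 2 = 1)
    (h16 : Module.finrank ℚ K = 16) (Φ : CMType K) :
    cmTypeRank Φ = 9 ∨ cmTypeRank Φ = 5 ∨ cmTypeRank Φ = 2 := by
  haveI := isAbelianGalois_of_sq_eq_one' hexp
  obtain ⟨φ₀⟩ := (inferInstance : Nonempty (K →+* ℂ))
  rw [cmTypeRank_eq_typeRank_galType Φ φ₀]
  exact CyclicCMType.ExponentTwo.typeRank_mem_of_card_sixteen hexp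
    (isCMTypeWith_galType (AbelianCMFieldExistence.apply_conjGal_eq φ₀) Φ) (by rw [card_gal_eq_finrank φ₀, h16])

/-- **Degree `16`: an even type has rank `5` or `2`.** [cite: Kubota1965, §4 Lemma 2] -/
theorem cmTypeRank_eq_five_or_two_of_even_of_finrank_eq_sixteen (hexp : ∀ g : K ≃ₐ[ℚ] K, g ^ 2 = 1)
    (h16 : Module.finrank ℚ K = 16) (Φ : CMType K) (F : IntermediateField ℚ K) (h2 : Module.finrank ℚ F = 2)
    (hF : ¬ IsTotallyReal F) (τ : F →+* ℂ) (hev : Even {φ : K →+* ℂ | φ.comp (algebraMap F K) = τ ∧ φ ∈ Φ.1}.ncard) :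
    cmTypeRank Φ = 5 ∨ cmTypeRank Φ = 2 := by
  have hle := sixteen_mul_cmTypeRank_sub_one_le hexp (by rw [h16]; norm_num) Φ F h2 hF τ hev
  rw [h16] at hle
  norm_num at hle
  have := cmTypeRank_mem_of_finrank_eq_sixteen hexp h16 Φ
  omega

end Degrees

/-! ## §5 `ℚ(ζ₂₄)` -/

section Cyclotomic

omit [IsCMField K] in
/-- `Gal(ℚ(ζₙ)/ℚ) ≅ (ℤ/n)ˣ` (Mathlib `IsCyclotomicExtension.Rat.galEquivZMod`): if every unit of `ℤ/n` squares to
`1` then `Gal(ℚ(ζₙ)/ℚ)` has exponent `2`. [folklore] -/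
private theorem gal_sq_eq_one' {n : ℕ} [NeZero n] [IsCyclotomicExtension {n} ℚ K]
    (h : ∀ u : (ZMod n)ˣ, u ^ 2 = 1) (g : K ≃ₐ[ℚ] K) : g ^ 2 = 1 :=
  (IsCyclotomicExtension.Rat.galEquivZMod n K).injective (by rw [map_pow, map_one, h])

omit [IsCMField K] in
/-- **`ℚ(ζ₂₄)`: EVERY CM TYPE HAS RANK `5` OR `2`**, and it is nondegenerate (rank `5`) iff its multiplicities over the
imaginary quadratic subfields `ℚ(i)`, `ℚ(√−2)`, `ℚ(√−3)`, `ℚ(√−6)` are odd (the `8` primitive types), of rank `2`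
iff they are even (the `8` types induced from these four fields). [cite: Kubota1965, §4 Lemma 2]
[cite: Dodson1984, §3.3.2 Theorem] -/
theorem cyclotomic_twentyFour_rank [IsCyclotomicExtension {24} ℚ K] (Φ : CMType K) :
    (cmTypeRank Φ = 5 ∨ cmTypeRank Φ = 2) ∧
      ∀ F : IntermediateField ℚ K, Module.finrank ℚ F = 2 → ¬ IsTotallyReal F → ∀ τ : F →+* ℂ,
        (IsNondegenerate Φ ↔ Odd {φ : K →+* ℂ | φ.comp (algebraMap F K) = τ ∧ φ ∈ Φ.1}.ncard) := by
  haveI := IsCyclotomicExtension.isGalois {24} ℚ K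
  haveI := IsCyclotomicExtension.Rat.isCMField K (S := {24}) ⟨24, rfl, by norm_num⟩
  have hexp : ∀ g : K ≃ₐ[ℚ] K, g ^ 2 = 1 := gal_sq_eq_one' (n := 24) (by decide)
  have h8 : Module.finrank ℚ K = 8 := by
    rw [IsCyclotomicExtension.finrank K (Polynomial.cyclotomic.irreducible_rat (show 0 < 24 by norm_num))]
    decide
  exact ⟨cmTypeRank_eq_five_or_two_of_finrank_eq_eight hexp h8 Φ,
    fun F h2 hF τ => isNondegenerate_iff_odd_of_finrank_eq_eight hexp h8 Φ F h2 hF τ⟩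

end Cyclotomic

/-! ## §6 Rank `2` iff induced from an imaginary quadratic subfield -/

section RankTwo

variable [IsGalois ℚ K]

/-- **RANK `2` ⟺ INDUCED FROM AN IMAGINARY QUADRATIC SUBFIELD.**  For a multiquadratic CM field `K` and a CM type
`Φ`: `Rank(Φ) = 2` iff there are an imaginary quadratic subfield `F ⊆ K` and an embedding `τ : F → ℂ` with
`Φ = {φ : K → ℂ : φ|_F = τ}` — the type induced from `(F, {τ})` (on `Gal(K/ℚ)`: `S = Gal(K/F)` or its complement,
`ExponentTwo.typeRank_eq_two_iff_exists_subgroup`).  [cite: Kubota1965, §4 Lemma 2]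
[cite: Shimura1998, §8.4 Example (2)(A)] [cite: Dodson1984, §3.1.1 Theorem] -/
theorem cmTypeRank_eq_two_iff_exists_eq_fibre (hexp : ∀ g : K ≃ₐ[ℚ] K, g ^ 2 = 1) (Φ : CMType K) :
    cmTypeRank Φ = 2 ↔ ∃ F : IntermediateField ℚ K, Module.finrank ℚ F = 2 ∧ ¬ IsTotallyReal F ∧
      ∃ τ : F →+* ℂ, Φ.1 = {φ : K →+* ℂ | φ.comp (algebraMap F K) = τ} := by
  haveI := isAbelianGalois_of_sq_eq_one' hexp
  obtain ⟨φ₀⟩ := (inferInstance : Nonempty (K →+* ℂ))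
  have hcm := isCMTypeWith_galType (AbelianCMFieldExistence.apply_conjGal_eq φ₀) Φ
  rw [cmTypeRank_eq_typeRank_galType Φ φ₀, CyclicCMType.ExponentTwo.typeRank_eq_two_iff_exists_subgroup hexp hcm]
  -- the dictionary `S = H ⟺ Φ = fibre of φ₀|_F`, `S = Hᶜ ⟺ Φ = fibre of conj φ₀|_F`, for `H = Gal(K/F)`
  have key : ∀ F : IntermediateField ℚ K, Module.finrank ℚ F = 2 → ¬ IsTotallyReal F →
      ((((Finset.univ.filter fun g : K ≃ₐ[ℚ] K => embOf φ₀ g ∈ Φ.1) : Finset (K ≃ₐ[ℚ] K)) : Set (K ≃ₐ[ℚ] K)) =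
          (F.fixingSubgroup : Set (K ≃ₐ[ℚ] K)) ↔
        Φ.1 = {φ : K →+* ℂ | φ.comp (algebraMap F K) = φ₀.comp (algebraMap F K)}) ∧
      ((((Finset.univ.filter fun g : K ≃ₐ[ℚ] K => embOf φ₀ g ∈ Φ.1) : Finset (K ≃ₐ[ℚ] K)) : Set (K ≃ₐ[ℚ] K)) =
          (F.fixingSubgroup : Set (K ≃ₐ[ℚ] K))ᶜ ↔
        Φ.1 = {φ : K →+* ℂ | φ.comp (algebraMap F K) =
          ComplexEmbedding.conjugate (φ₀.comp (algebraMap F K))}) := by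
    intro F h2 hF
    constructor
    · rw [Set.ext_iff, Set.ext_iff]
      simp only [Finset.coe_filter, Finset.mem_univ, true_and, Set.mem_setOf_eq, SetLike.mem_coe]
      constructor
      · intro h φ
        obtain ⟨g, rfl⟩ := (embOf_bijective φ₀).2 φ
        rw [h g, mem_fixingSubgroup_iff_embOf_comp_eq φ₀ F g]
      · intro h g
        rw [h (embOf φ₀ g), mem_fixingSubgroup_iff_embOf_comp_eq φ₀ F g]
    · rw [Set.ext_iff, Set.ext_iff]
      simp only [Finset.coe_filter, Finset.mem_univ, true_and, Set.mem_setOf_eq, Set.mem_compl_iff,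
        SetLike.mem_coe]
      constructor
      · intro h φ
        obtain ⟨g, rfl⟩ := (embOf_bijective φ₀).2 φ
        rw [h g, not_mem_fixingSubgroup_iff_embOf_comp_eq_conjugate φ₀ F h2 hF g]
      · intro h g
        rw [h (embOf φ₀ g), not_mem_fixingSubgroup_iff_embOf_comp_eq_conjugate φ₀ F h2 hF g]
  constructor
  · rintro ⟨H, hρH, hidx, hS⟩
    have h2 : Module.finrank ℚ (fixedField H) = 2 := by rw [← index_eq_finrank_fixedField, hidx]
    have hF : ¬ IsTotallyReal (fixedField H) := (conjGal_not_mem_iff_not_isTotallyReal_fixedField H).1 hρH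
    have hHF : (H : Set (K ≃ₐ[ℚ] K)) = ((fixedField H).fixingSubgroup : Set (K ≃ₐ[ℚ] K)) := by
      rw [fixingSubgroup_fixedField]
    refine ⟨fixedField H, h2, hF, ?_⟩
    rcases hS with hS | hS
    · exact ⟨φ₀.comp (algebraMap (fixedField H) K), ((key (fixedField H) h2 hF).1).1 (hS.trans hHF)⟩
    · exact ⟨ComplexEmbedding.conjugate (φ₀.comp (algebraMap (fixedField H) K)),
        ((key (fixedField H) h2 hF).2).1 (hS.trans (by rw [hHF]))⟩
  · rintro ⟨F, h2, hF, τ, hΦ⟩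
    have hρH : (conjGal : K ≃ₐ[ℚ] K) ∉ F.fixingSubgroup := (conjGal_not_mem_fixingSubgroup_iff F).2 hF
    refine ⟨F.fixingSubgroup, hρH, index_fixingSubgroup_eq_two F h2, ?_⟩
    obtain ⟨g, hg⟩ := exists_embOf_comp_eq φ₀ F τ
    by_cases hmem : g ∈ F.fixingSubgroup
    · have hτ : τ = φ₀.comp (algebraMap F K) :=
        hg.symm.trans ((mem_fixingSubgroup_iff_embOf_comp_eq φ₀ F g).1 hmem)
      rw [hτ] at hΦ
      exact Or.inl (((key F h2 hF).1).2 hΦ)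
    · have hτ : τ = ComplexEmbedding.conjugate (φ₀.comp (algebraMap F K)) :=
        hg.symm.trans ((not_mem_fixingSubgroup_iff_embOf_comp_eq_conjugate φ₀ F h2 hF g).1 hmem)
      rw [hτ] at hΦ
      exact Or.inr (((key F h2 hF).2).2 hΦ)

/-- **A rank-`2` type has a non-trivial stabiliser** (it is stable under `Gal(K/F)` for its inducing subfield
`F`): if `Rank(Φ) = 2` and `[K:ℚ] ≥ 8` (so that `Gal(K/F) ≠ 1`), some `g ≠ 1` in `Gal(K/ℚ)` satisfies
`φ ∘ g ∈ Φ ⟺ φ ∈ Φ` for all `φ` — the type is not primitive (Shimura's Prop. 26).  Hence in degree `8` every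
PRIMITIVE type — every simple CM abelian fourfold with Galois group `(ℤ/2)³` — is nondegenerate (rank `5`).
[cite: Dodson1984, §3.3.2 Theorem] [cite: Shimura1998, §8.2 Prop. 26] -/
theorem exists_ne_one_stabilizer_of_cmTypeRank_eq_two (hexp : ∀ g : K ≃ₐ[ℚ] K, g ^ 2 = 1)
    (h8 : 8 ≤ Module.finrank ℚ K) (Φ : CMType K) (hr : cmTypeRank Φ = 2) :
    ∃ g : K ≃ₐ[ℚ] K, g ≠ 1 ∧ ∀ φ : K →+* ℂ, φ.comp (g : K →+* K) ∈ Φ.1 ↔ φ ∈ Φ.1 := by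
  haveI := isAbelianGalois_of_sq_eq_one' hexp
  obtain ⟨F, h2, hF, τ, hΦ⟩ := (cmTypeRank_eq_two_iff_exists_eq_fibre hexp Φ).1 hr
  -- `Gal(K/F)` has order `[K:ℚ]/2 ≥ 4 > 1`: pick `g ≠ 1` in it
  have hcard : Nat.card F.fixingSubgroup = Module.finrank ℚ K / 2 := by
    obtain ⟨φ₀⟩ := (inferInstance : Nonempty (K →+* ℂ))
    have h1 := F.fixingSubgroup.index_mul_card
    rw [index_fixingSubgroup_eq_two F h2, Nat.card_eq_fintype_card (α := K ≃ₐ[ℚ] K), card_gal_eq_finrank φ₀] at h1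
    omega
  have hnt : ∃ g : F.fixingSubgroup, g ≠ 1 := by
    by_contra hall
    have hall' : ∀ g : F.fixingSubgroup, g = 1 := fun g => by_contra fun hne => hall ⟨g, hne⟩
    haveI : Subsingleton F.fixingSubgroup := ⟨fun a b => by rw [hall' a, hall' b]⟩
    have : Nat.card F.fixingSubgroup = 1 := Nat.card_of_subsingleton 1
    omega
  obtain ⟨⟨g, hgH⟩, hg1⟩ := hnt
  refine ⟨g, fun h1 => hg1 (Subtype.ext h1), fun φ => ?_⟩
  -- `g` fixes `F` pointwise, so `φ ∘ g` and `φ` agree on `F`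
  have hfix : (φ.comp (g : K →+* K)).comp (algebraMap F K) = φ.comp (algebraMap F K) := by
    ext x
    show φ (g (x : K)) = φ (x : K)
    rw [(IntermediateField.mem_fixingSubgroup_iff F g).1 hgH (x : K) x.2]
  rw [hΦ, Set.mem_setOf_eq, Set.mem_setOf_eq, hfix]

end RankTwo

end Multiquadratic

end Literature.AlgebraicGeometry.Pohlmann1968
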